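import Summits.QuantumFields.YangMills.Theorems.BalabanUVNodesN15SiteCurvedOperatorEntryThree
import Summits.QuantumFields.YangMills.Theorems.BalabanUVNodesN15SiteCurvedCarriersLive
import HarnessLib

/-!
# Route «BalabanUVNodes», cluster K4 «SpineRates» — node N15 = NE2: THE SITE LAYER WITH THE BACKGROUND LIVE IN THE TwoGrid ENTRY CURRENCY, XL — THE CURVED KING FAMILY's
# `NE2PlusOperator` AND `Live ∧ N15At` BUNDLE WITH ONLY OPERATOR ENTRY 2 DISPLAYED (parts XXXVI ∕ XXXVII fed part XXXIX's entry-3 row)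

Cell `pub-ymgap`, WIDTH SEAT `pub-ymgap-dag-n15-w1` (generation 5; director-ym №197 ∕ HUMAN RULING D-0149, №219 (1); chair R455 (A) ∕ R461; dag-lead KEY MAP v2 INBOX l.35754;
the located sequel (o1) of dag-n15-e g15 INBOX l.39322 ∕ l.39620; CLAIM-5).  `bears_on: R4∕N15 · K3⁸ SpineGivenEndpointR13SepCoPHV (stmt-QuantumFields-27366; K3⁷ 20544 aside =
lineage)`.  Filed `--kind proof --supports stmt-QuantumFields-27366 --as helper` — COUNT-NEUTRAL.  THEOREMS ONLY (0 `def`, 0 `sorry`).  Imports BY NAME part XXXIX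
`…N15SiteCurvedOperatorEntryThree` (`curvOp_letters3`), part XXXVII `…N15SiteCurvedCarriersLive` (`live_and_n15At_curvCarriers_of_rows23`; through it XXXVI
`ne2PlusOperator_curvKop_of_rows23`); nothing in the tree is modified.

WHY ∕ CONTENTS.  Parts XXXVI ∕ XXXVII displayed TWO operator rows (entries 2 and 3); part XXXIX proved the row of entry 3.  Here the two bundle theorems are re-issued with ONLY the row of
entry 2 (`X∇*_μ`, source derivative) displayed: ★★ `ne2PlusOperator_curvKop_of_row2`, ★★★ `live_and_n15At_curvCarriers_of_row2`.  The remaining row is the LOCATED obstruction of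
dag-n15-e g15 INBOX l.39620 (B) ∕ dag-n15-d g18 l.40235 (1): the stacked-pair knit would read the mixed kernel `∇G∇*`, which has no `K`-uniform ℓ^∞ two-grid row (Calderón–Zygmund;
rate-less on the diagonal block); the door is the right-dressed tuple `(X, X∘N∂, X∘D*)` (l.40235 (2)) — not typed here.

HONEST FRAMING ∕ LIMITS.  Count-neutral two-line re-issue.  MODEL-LEVEL (King's `A = 0` massless propagator dressed by exact adjoint transporters of a small potential; one blocking
step; block-mean coarse potential; flat base point ∕ flat Laplacian; unit layer U-blind and massive); NOT Bałaban's `G(U)` ∕ `C^{(k)}(U)`; nothing of [B5]∕[B6]∕[B9] asserted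
((3.35)–(3.37) p. 396, Thm 3.1 (3.42) p. 397, Thm 3.2 (3.48) p. 398, Thm 3.15 (3.187) p. 432 = SHAPES).  NE2⁺ NOT PRINTED ∕ NOT proved for d = 4; **N15 is NOT discharged**; K3⁸ OPEN,
not claimed, skeleton v6 untouched (its N15 pin is `fullGSizedObjects`; nothing re-pinned; `KeyedLive` untouched); counts of record UNMOVED (typed 28∕28 · discharged 5∕27, A 5∕28);
one finite four-torus programme at fixed `ε` — NOT ℝ⁴, NOT infinite volume, NOT OS, NOT a mass gap, NOT Clay; R4 closes the conditional finite-𝕋⁴ rung `BalabanLadder.UV` only.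
Restate-immune (no Theses import).
-/

set_option autoImplicit false

noncomputable section
open scoped BigOperators Matrix Matrix.Norms.Frobenius

namespace Summit.QuantumFields.YangMills.BalabanUVNodes.N15.SiteLayerBg

open Literature.MathematicalPhysics.QuantumFieldTheory.Balaban1983to89
open Literature.MathematicalPhysics.QuantumFieldTheory.Balaban1983to89.B11SectG (BlockNorm HasMaj)
open Literature.MathematicalPhysics.QuantumFieldTheory.Balaban1983to89.T4EtaRate (NE2PlusOperator)
open Literature.MathematicalPhysics.QuantumFieldTheory.Balaban1983to89.B5Prop11Plancherel (Tor fine)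
open Literature.MathematicalPhysics.QuantumFieldTheory.King1986.Torus (blockOf tdistT)
open Literature.Barriers.QuantumFields (traceForm)
open Summit.QuantumFields.YangMills.BalabanUVNodes.N15.VectorPiece (unitTorusGeoS)
open Summit.QuantumFields.YangMills.BalabanUVNodes.N15.MatrixSpecies (liftBlk)
open Summit.QuantumFields.YangMills.BalabanUVNodes.N15.PairedFamilyGuard (Live)
open Summit.QuantumFields.YangMills.BalabanUVNodes.N15KingModelRung (KingVolIndex)
open YMDAG.UVSplit (NE2Carriers N15At)

variable {d : ℕ} (L : ℕ) [NeZero L]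
variable {n : Type} [Fintype n] [DecidableEq n] (κ : Type) [Fintype κ] [DecidableEq κ] (e : Matrix n n ℂ ≃L[ℝ] (κ → ℝ)) (a : ℝ)

/-! ## The two bundle theorems with only entry 2 displayed -/

section Bundle

/-- ★★ **`NE2PlusOperator` BY NAME FOR THE CURVED KING FAMILY WITH ONLY ENTRY 2 DISPLAYED** (part XXXVI `ne2PlusOperator_curvKop_of_rows23` with `h3 := curvOp_letters3`):
the displayed row `h2` of entry 2 (`X∇*_μ`) is the located obstruction of dag-n15-e g15 INBOX l.39620 (B) ∕ dag-n15-d g18 l.40235 (1) (no `K`-uniform ℓ^∞ two-grid row through the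
stacked knit; door: right-dressing, l.40235 (2)). [cite: Balaban1985BackgroundPropagators, Thm 3.1 (3.42) p.397 + Thm 3.14 pp.426–427 (quantifier template); King1986, Prop. 3.9 (3.73) p.665 (rate factor)] -/
theorem ne2PlusOperator_curvKop_of_row2 (he : ∀ X Y : Matrix n n ℂ, traceForm X Y = e X ⬝ᵥ e Y) (hLodd : Odd L) (hL : 2 ≤ L) (ha : 0 < a) (c35 : ℝ)
    (h2 : ∃ δ₂ C₂ b₂ : ℝ, 0 < δ₂ ∧ 0 < C₂ ∧ 0 < b₂ ∧
      ∀ (i : KingVolIndex d × Fin (d + 1)) (α₀ : ℝ), 0 < α₀ → i.1.Msz * α₀ ≤ b₂ → ∀ U : (curvBgF L n i.1).Cfg, (curvBgF L n i.1).Reg335 c35 α₀ U →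
        HasMaj (BlockNorm.ofBlocks (unitTorusGeoS L i.1.K (curvCube L i.1) i.1.Msz) (liftBlk (blockOf (L ^ i.1.K) (curvCube L i.1)) κ))
          (BlockNorm.ofBlocks (unitTorusGeoS L i.1.K (curvCube L i.1) i.1.Msz) (liftBlk (blockOf (L ^ i.1.K) (curvCube L i.1) ∘ blockOf L (fine (L ^ i.1.K) (curvCube L i.1))) κ))
          (curvOpT L κ e a i 2 U) (fun y y' => C₂ * ((L : ℝ) ^ i.1.K) ^ (-(1 / 4 : ℝ)) * Real.exp (-(δ₂ * tdistT (curvCube L i.1) y y')))) :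
    NE2PlusOperator c35 (fun i : KingVolIndex d × Fin (d + 1) => curvPI L κ n i.1) (curvKop L κ e a) :=
  ne2PlusOperator_curvKop_of_rows23 (d := d) L κ e a he hLodd hL ha c35 h2 (curvOp_letters3 (d := d) L κ e a he hLodd hL ha c35)

/-- ★★★ **THE CURVED KING FAMILY's `Live ∧ N15At` BUNDLE WITH ONLY ENTRY 2 DISPLAYED** (part XXXVII `live_and_n15At_curvCarriers_of_rows23` with `h3 := curvOp_letters3`): odd `L ≥ 3`,
`a > 0`, trace-form-orthonormal `e`, `c₃₅ ≥ 0`, unit mass `m² > 0`, site exponent `p`, colour selectors `(c, c′)`, and the ONE displayed row `h2` ⟹ `Live c ∧ N15At c` for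
`c = curvCarriers …` — operator entries 0, 1, 3 and the site layer read the potential through the EXACT adjoint transporters; the unit layer is King's U-blind covariance step.
[cite: Balaban1985BackgroundPropagators, Thm 3.1 (3.42) p.397, Thm 3.2 (3.48) p.398, Thm 3.15 (3.187) p.432 (shapes); King1986, Lemma 4.5 (4.38) p.674, Prop. 3.9 (3.73) p.665 (model)] -/
theorem live_and_n15At_curvCarriers_of_row2 (he : ∀ X Y : Matrix n n ℂ, traceForm X Y = e X ⬝ᵥ e Y) (hLodd : Odd L) (hL : 2 ≤ L) (ha : 0 < a) {c35 : ℝ} (hc35 : 0 ≤ c35)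
    {m2 : ℝ} (hm : 0 < m2) (p : ℝ) (c c' : KingVolIndex d → κ)
    (h2 : ∃ δ₂ C₂ b₂ : ℝ, 0 < δ₂ ∧ 0 < C₂ ∧ 0 < b₂ ∧
      ∀ (i : KingVolIndex d × Fin (d + 1)) (α₀ : ℝ), 0 < α₀ → i.1.Msz * α₀ ≤ b₂ → ∀ U : (curvBgF L n i.1).Cfg, (curvBgF L n i.1).Reg335 c35 α₀ U →
        HasMaj (BlockNorm.ofBlocks (unitTorusGeoS L i.1.K (curvCube L i.1) i.1.Msz) (liftBlk (blockOf (L ^ i.1.K) (curvCube L i.1)) κ))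
          (BlockNorm.ofBlocks (unitTorusGeoS L i.1.K (curvCube L i.1) i.1.Msz) (liftBlk (blockOf (L ^ i.1.K) (curvCube L i.1) ∘ blockOf L (fine (L ^ i.1.K) (curvCube L i.1))) κ))
          (curvOpT L κ e a i 2 U) (fun y y' => C₂ * ((L : ℝ) ^ i.1.K) ^ (-(1 / 4 : ℝ)) * Real.exp (-(δ₂ * tdistT (curvCube L i.1) y y')))) :
    Live (curvCarriers L κ e a c35 p m2 c c') ∧ N15At (curvCarriers L κ e a c35 p m2 c c') :=
  live_and_n15At_curvCarriers_of_rows23 (d := d) L κ e a he hLodd hL ha hc35 hm p c c' h2 (curvOp_letters3 (d := d) L κ e a he hLodd hL ha c35)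


end Bundle

end Summit.QuantumFields.YangMills.BalabanUVNodes.N15.SiteLayerBg

end
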